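import Summits.ResolutionOfSingularities.ResolutionOfSingularities.Theorems.EquisingularLiftEquisingularLiftNatTransitionKernelCharts
import Mathlib.RingTheory.RingHom.Flat
import HarnessLib

/-!
# [OURS · L1 W4.5(b) · EL♮(3) · (T-k) · J1c brick B4, chart dictionary D2] The chart ring of `Yₙ` is flat over the previous level

Crux EL♮(3) = stmt-ResolutionOfSingularities-20148; J1 = `EmbeddedInfinitesimalLiftFact` (p596985) ⟸ `EmbeddedInfinitesimalChartLiftFact` (p603689).
Written by res-L1-w45b-stub-4 g10 (brick B4 = (λ♯) of `L/res-type-027/J1c-DESIGN-v2.md` §2; desk R11 (v) / R12′ (iii)). OURS; NOT a statement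
of H. Hironaka's 2017 manuscript; AI-written, weaker than expert review. No `sorry`; standard axioms; DEF-FREE.
`--supports stmt-ResolutionOfSingularities-20148 --as helper`.

WHAT. The ring core of B4 (`exists_flat_lift_sup_eq_of_isWeaklyRegular_fiber`, …NatEmbeddedLiftChartLocalRing, p606077) is stated over an
Artinian base `C'` with the previous level `J ≤ C'` and asks, as a typeclass hypothesis, that the chart ring of `Yₙ`
`(A' ⧸ J·A') ⧸ K̄` be flat over `C' ⧸ J`. This file discharges that hypothesis in the geometric situation of
`EmbeddedInfinitesimalChartLiftFact`: `C' := O ⧸ 𝔪ⁿ⁺²`, `A' := Γ(Wₙ₊₁, U)` (`U` affine, `C'`-algebra through `toSpec (n+1)`),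
`J := ker (O ⧸ 𝔪ⁿ⁺² → O ⧸ 𝔪ⁿ⁺¹)`, `K := ` the ideal of `Yₙ` in `A'` (pull-back of `ker (jn.app (t⁻¹U))` along `t.app U`, `t` the transition).
* `moduleFlat_doubleQuot_of_flat_comp` — pure algebra: transport of flatness along the isomorphisms `C' ⧸ J ≅ Cₙ` and
  `(A' ⧸ JA') ⧸ K̄ ≅ A' ⧸ K ≅ Γ(Yₙ, ·)` induced by surjections `C' ↠ Cₙ`, `A' ↠ B ↠ D` with `ker (A' ↠ B) = JA'` and a flat `Cₙ → D`
  compatible with the structure maps (`RingHom.Flat.comp_iff_of_bijective_left/right`).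
* `moduleFlat_chart_quotient_of_isPullback` — the same over an ABSTRACT cartesian square `t ≫ p' = pn ≫ Spec φ` (`φ` surjective), a closed
  immersion `jn : Y ↪ Xₙ` with `Y → Spec S` flat and an affine chart `U ⊆ X` (stated abstractly so that the kernel never unfolds the
  pullback presentation of `Wₙ`): D1 `ker_app_eq_map_of_isPullback_specMap` (p606078), `Scheme.Hom.app_surjective`,
  `HasRingHomProperty.appLE @Flat`, `Scheme.Hom.appLE_comp_appLE` / `comp_appLE` and `ΓSpecIso_inv_naturality`.
* `moduleFlat_chart_level_quotient` — D2 proper: the instance the ring core wants for `Wₙ ↪ Wₙ₊₁`, `jn : Yₙ ↪ Wₙ` a closed immersion with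
  `Flat (jn ≫ toSpec n)`, at the cartesian square `isPullback_transition` (p606078). [cite: Hartshorne2010, Thm. 9.2 (b), (c)] (index only) [folklore]
-/

set_option linter.dupNamespace false

noncomputable section

open CategoryTheory CategoryTheory.Limits AlgebraicGeometry TopologicalSpace
open Literature.AlgebraicGeometry.Morphisms (infinitesimalNeighbourhood)
open Literature.AlgebraicGeometry.Resolution

namespace Summit.ResolutionOfSingularities.ResolutionOfSingularities.Cruxes.EquisingularLiftNat.Sections

/-- **Flatness of the double quotient, transported.** `C' ↠ Cₙ` with kernel `J`, `φ : A' ↠ B` with kernel `J·A'`, `ψ : B ↠ D`,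
`g : Cₙ → D` flat with `ψ ∘ φ ∘ algebraMap = g ∘ (C' ↠ Cₙ)`, `K = φ⁻¹(ker ψ)`: then `(A' ⧸ JA') ⧸ K̄` is flat over `C' ⧸ J`
(it is `D` over `Cₙ` up to the evident isomorphisms). [folklore] -/
theorem moduleFlat_doubleQuot_of_flat_comp {C' A' Cn B D : Type*} [CommRing C'] [CommRing A'] [Algebra C' A'] [CommRing Cn]
    [CommRing B] [CommRing D]
    (trh : C' →+* Cn) (htrh : Function.Surjective trh) (J : Ideal C') (hJ : J = RingHom.ker trh)
    (φ : A' →+* B) (hφ : Function.Surjective φ) (hkerφ : RingHom.ker φ = J.map (algebraMap C' A'))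
    (ψ : B →+* D) (hψ : Function.Surjective ψ)
    (g : Cn →+* D) (hg : g.Flat) (hcomm : (ψ.comp φ).comp (algebraMap C' A') = g.comp trh)
    (K : Ideal A') (hK : K = (RingHom.ker ψ).comap φ) :
    Module.Flat (C' ⧸ J) ((A' ⧸ J.map (algebraMap C' A')) ⧸ K.map (Ideal.Quotient.mk (J.map (algebraMap C' A')))) := by
  set JA : Ideal A' := J.map (algebraMap C' A') with hJA
  -- the composite surjection `Φ = ψ ∘ φ : A' ↠ D`, kernel `K`
  set Φ : A' →+* D := ψ.comp φ with hΦ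
  have hΦs : Function.Surjective Φ := hψ.comp hφ
  have hkerΦ : RingHom.ker Φ = K := by rw [hK, hΦ, RingHom.comap_ker]
  have hJAK : JA ≤ K := by
    rw [hK, ← hkerφ]
    intro a ha
    rw [Ideal.mem_comap, RingHom.mem_ker, RingHom.mem_ker.mp ha, map_zero]
  -- `e₂ : (A' ⧸ JA) ⧸ K̄ ≃+* D`
  let e₂ : (A' ⧸ JA) ⧸ K.map (Ideal.Quotient.mk JA) ≃+* D :=
    (DoubleQuot.quotQuotEquivQuotOfLE hJAK).trans
      ((Ideal.quotEquivOfEq hkerΦ.symm).trans (RingHom.quotientKerEquivOfSurjective hΦs))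
  have he₂ : ∀ a : A', e₂ (Ideal.Quotient.mk _ (Ideal.Quotient.mk JA a)) = Φ a := by
    intro a
    rfl
  -- `e₁ : C' ⧸ J →+* Cn`, bijective
  have hJle : J ≤ RingHom.ker trh := hJ.le
  let e₁ : C' ⧸ J →+* Cn := Ideal.Quotient.lift J trh fun c hc => hJle hc
  have he₁ : Function.Bijective e₁ := by
    constructor
    · rw [RingHom.injective_iff_ker_eq_bot, RingHom.ker_eq_bot_iff_eq_zero]
      intro x hx
      obtain ⟨c, rfl⟩ := Ideal.Quotient.mk_surjective x
      rw [Ideal.Quotient.lift_mk] at hx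
      exact Ideal.Quotient.eq_zero_iff_mem.mpr (hJ ▸ hx)
    · intro y
      obtain ⟨c, rfl⟩ := htrh y
      exact ⟨Ideal.Quotient.mk J c, by rw [Ideal.Quotient.lift_mk]⟩
  -- the structure map of the double quotient, conjugated, is `g`
  set α := algebraMap (C' ⧸ J) ((A' ⧸ JA) ⧸ K.map (Ideal.Quotient.mk JA)) with hα
  have hconj : e₂.toRingHom.comp α = g.comp e₁ := by
    refine Ideal.Quotient.ringHom_ext (RingHom.ext fun c => ?_)
    have h1 : α (Ideal.Quotient.mk J c) = Ideal.Quotient.mk _ (Ideal.Quotient.mk JA (algebraMap C' A' c)) := rfl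
    have h2 := congrArg (fun h : C' →+* D => h c) hcomm
    simp only [RingHom.comp_apply] at h2
    rw [RingHom.comp_apply, RingHom.comp_apply, RingHom.comp_apply, RingHom.comp_apply, h1, RingEquiv.toRingHom_eq_coe,
      RingHom.coe_coe, he₂, Ideal.Quotient.lift_mk, ← h2, hΦ, RingHom.comp_apply]
  have hαflat : α.Flat := by
    have h : (e₂.toRingHom.comp α).Flat := by
      rw [hconj]; exact RingHom.Flat.comp (RingHom.Flat.of_bijective he₁) hg
    exact (RingHom.Flat.comp_iff_of_bijective_left (f := α) (g := e₂.toRingHom) e₂.bijective).mp h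
  exact RingHom.flat_algebraMap_iff.mp hαflat

/-- **D2, abstract form — the chart ring of a flat closed subscheme of a base-changed level is flat over the level.** For a cartesian
square `t ≫ p' = pn ≫ Spec φ` over a SURJECTIVE `φ : R → S` (so `t : Xₙ ↪ X` is a closed immersion), a closed immersion `jn : Y ↪ Xₙ` with
`Y → Spec S` flat, an affine open `U ⊆ X` whose ring is an `R`-algebra through `p'` (hypothesis `halg`), `J = ker φ` and `K` the pull-back along
`t.app U` of `ker (jn.app (t⁻¹U))`: `(Γ(X,U) ⧸ J·Γ(X,U)) ⧸ K̄` is flat over `R ⧸ J`. [cite: Hartshorne2010, Thm. 9.2 (b)] (index only) [folklore] -/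
theorem moduleFlat_chart_quotient_of_isPullback {X Xn Y : Scheme.{0}} {R S : CommRingCat.{0}} (φ : R ⟶ S)
    (hφ : Function.Surjective φ.hom) {t : Xn ⟶ X} {pn : Xn ⟶ Spec S} {p' : X ⟶ Spec R} (H : IsPullback t pn p' (Spec.map φ))
    (jn : Y ⟶ Xn) [IsClosedImmersion jn] [hfl : Flat (jn ≫ pn)] (U : X.affineOpens)
    [Algebra R Γ(X, U)] (halg : algebraMap R Γ(X, U) = (p'.appLE ⊤ U le_top).hom.comp (Scheme.ΓSpecIso R).inv.hom)
    (J : Ideal R) (hJ : J = RingHom.ker φ.hom) (K : Ideal Γ(X, U))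
    (hK : K = (RingHom.ker (jn.app (t ⁻¹ᵁ (U : X.Opens))).hom).comap (t.app (U : X.Opens)).hom) :
    Module.Flat (R ⧸ J) ((Γ(X, U) ⧸ J.map (algebraMap R Γ(X, U))) ⧸ K.map (Ideal.Quotient.mk (J.map (algebraMap R Γ(X, U))))) := by
  haveI : IsClosedImmersion (Spec.map φ) := IsClosedImmersion.spec_of_surjective _ hφ
  haveI : IsClosedImmersion t := MorphismProperty.IsStableUnderBaseChange.of_isPullback H.flip inferInstance
  -- the charts
  have hU' : IsAffineOpen (t ⁻¹ᵁ U.1) := U.2.preimage _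
  have hV : IsAffineOpen (jn ⁻¹ᵁ (t ⁻¹ᵁ U.1)) := hU'.preimage jn
  have hφs : Function.Surjective (t.app U.1).hom := t.app_surjective _ U.2
  have hψs : Function.Surjective (jn.app (t ⁻¹ᵁ U.1)).hom := jn.app_surjective _ hU'
  -- the flat structure map of the `Y`-chart over `S`
  have hgflat : (((jn ≫ pn).appLE ⊤ (jn ⁻¹ᵁ (t ⁻¹ᵁ U.1)) le_top).hom.comp (Scheme.ΓSpecIso S).inv.hom).Flat := by
    refine RingHom.Flat.comp (RingHom.Flat.of_bijective (ConcreteCategory.bijective_of_isIso _)) ?_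
    exact HasRingHomProperty.appLE @Flat (jn ≫ pn) hfl ⟨⊤, isAffineOpen_top _⟩ ⟨_, hV⟩ le_top
  refine moduleFlat_doubleQuot_of_flat_comp φ.hom hφ J hJ _ hφs ?_ _ hψs _ hgflat ?_ K hK
  · -- `ker (t.app U) = J·Γ(X,U)` (D1)
    rw [ker_app_eq_map_of_isPullback_specMap φ hφ H U, hJ, halg, ← Ideal.map_map]
    congr 1
    exact (Ideal.map_symm (Scheme.ΓSpecIso R).commRingCatIsoToRingEquiv).symm
  · -- compatibility of the structure maps: `ψ ∘ φ_t ∘ algebraMap = g ∘ φ`, from `t ≫ p' = pn ≫ Spec φ`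
    have hL : p'.appLE ⊤ U.1 le_top ≫ t.app U.1 ≫ jn.app (t ⁻¹ᵁ U.1) = (jn ≫ t ≫ p').appLE ⊤ (jn ⁻¹ᵁ (t ⁻¹ᵁ U.1)) le_top := by
      rw [Scheme.Hom.app_eq_appLE t, Scheme.Hom.app_eq_appLE jn, Scheme.Hom.appLE_comp_appLE, Scheme.Hom.appLE_comp_appLE]
      simp only [Category.assoc]
    have hmor : jn ≫ t ≫ p' = (jn ≫ pn) ≫ Spec.map φ := by rw [Category.assoc, H.w]
    have hR : (jn ≫ t ≫ p').appLE ⊤ (jn ⁻¹ᵁ (t ⁻¹ᵁ U.1)) le_top =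
        (Spec.map φ).appTop ≫ (jn ≫ pn).appLE ⊤ (jn ⁻¹ᵁ (t ⁻¹ᵁ U.1)) le_top := by
      simp only [hmor, Scheme.Hom.comp_appLE, TopologicalSpace.Opens.map_top]
    have key : (Scheme.ΓSpecIso R).inv ≫ p'.appLE ⊤ U.1 le_top ≫ t.app U.1 ≫ jn.app (t ⁻¹ᵁ U.1) =
        φ ≫ (Scheme.ΓSpecIso S).inv ≫ (jn ≫ pn).appLE ⊤ (jn ⁻¹ᵁ (t ⁻¹ᵁ U.1)) le_top := by
      rw [hL, hR, Scheme.ΓSpecIso_inv_naturality_assoc]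
    have key' := congrArg (fun f => CommRingCat.Hom.hom f) key
    simp only [CommRingCat.hom_comp] at key'
    rw [halg]
    simp only [RingHom.comp_assoc] at key' ⊢
    exact key'

/-- **D2 — the chart ring of `Yₙ` is flat over the previous level.** For `jn : Yₙ ↪ Wₙ` a closed immersion with `Yₙ → Spec (O ⧸ 𝔪ⁿ⁺¹)`
flat, `U ⊆ Wₙ₊₁` affine, `A' := Γ(Wₙ₊₁, U)` a `C' := O ⧸ 𝔪ⁿ⁺²`-algebra through `toSpec (n+1)` (hypothesis `halg`), `J := ker (C' → O ⧸ 𝔪ⁿ⁺¹)`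
and `K :=` the pull-back along `t.app U` of `ker (jn.app (t⁻¹U))` (`t` the transition): `(A' ⧸ JA') ⧸ K̄` is flat over `C' ⧸ J` — the
typeclass hypothesis of the B4 ring core `exists_flat_lift_sup_eq_of_isWeaklyRegular_fiber` (p606077); by the abstract form at the
cartesian square `isPullback_transition` (p606078). [cite: Hartshorne2010, Thm. 9.2 (b)] (index only) [folklore] -/
theorem moduleFlat_chart_level_quotient {O : Type} [CommRing O] (𝔪 : Ideal O) {W : Scheme.{0}} (w : W ⟶ Spec (.of O)) (n : ℕ)
    {Yn : Scheme.{0}} (jn : Yn ⟶ infinitesimalNeighbourhood 𝔪 w n) [IsClosedImmersion jn]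
    [Flat (jn ≫ infinitesimalNeighbourhood.toSpec 𝔪 w n)]
    (U : (infinitesimalNeighbourhood 𝔪 w (n + 1)).affineOpens)
    [Algebra (O ⧸ 𝔪 ^ (n + 2)) Γ(infinitesimalNeighbourhood 𝔪 w (n + 1), U)]
    (halg : algebraMap (O ⧸ 𝔪 ^ (n + 2)) Γ(infinitesimalNeighbourhood 𝔪 w (n + 1), U) =
      ((infinitesimalNeighbourhood.toSpec 𝔪 w (n + 1)).appLE ⊤ U le_top).hom.comp
        (Scheme.ΓSpecIso (.of (O ⧸ 𝔪 ^ (n + 2)))).inv.hom)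
    (J : Ideal (O ⧸ 𝔪 ^ (n + 2))) (hJ : J = RingHom.ker (infinitesimalNeighbourhood.transitionRingHom 𝔪 n))
    (K : Ideal Γ(infinitesimalNeighbourhood 𝔪 w (n + 1), U))
    (hK : K = (RingHom.ker (jn.app ((infinitesimalNeighbourhood.transition 𝔪 w n) ⁻¹ᵁ
        (U : (infinitesimalNeighbourhood 𝔪 w (n + 1)).Opens))).hom).comap
      ((infinitesimalNeighbourhood.transition 𝔪 w n).app (U : (infinitesimalNeighbourhood 𝔪 w (n + 1)).Opens)).hom) :
    Module.Flat ((O ⧸ 𝔪 ^ (n + 2)) ⧸ J)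
      ((Γ(infinitesimalNeighbourhood 𝔪 w (n + 1), U) ⧸ J.map (algebraMap (O ⧸ 𝔪 ^ (n + 2)) Γ(infinitesimalNeighbourhood 𝔪 w (n + 1), U))) ⧸
        K.map (Ideal.Quotient.mk (J.map (algebraMap (O ⧸ 𝔪 ^ (n + 2)) Γ(infinitesimalNeighbourhood 𝔪 w (n + 1), U))))) :=
  moduleFlat_chart_quotient_of_isPullback (CommRingCat.ofHom (infinitesimalNeighbourhood.transitionRingHom 𝔪 n))
    (Ideal.Quotient.factor_surjective (Ideal.pow_le_pow_right (Nat.le_succ _))) (isPullback_transition 𝔪 w n) jn U halg J hJ K hK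

end Summit.ResolutionOfSingularities.ResolutionOfSingularities.Cruxes.EquisingularLiftNat.Sections

end
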